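import Literature.AlgebraicGeometry.Frobenioids.ModelFrobenioidUnits

/-!
# Frobenioids I, §5: the birational side of the model Frobenioid, explicitly (Prop. 4.4 (iv), Thm. 5.2 (ii))

Mochizuki, *The geometry of Frobenioids I: the general theory*, Kyushu J. Math. **62** (2008), §4
Prop. 4.4 and §5 Thm. 5.2 (ii), kurims text pp. 83–84, 101 [cite: MochizukiFrdI2008, Thm. 5.2(ii) p.101].
For the model Frobenioid `C = ModelFrobenioid Φ B Div_B` the "rational function monoid" of the
birationalization is `B` itself ("there is a natural isomorphism of functors between the functor
`O^×(−)` on `D` associated to the Frobenioid `C^birat` […] and the functor `B`", Thm. 5.2 (ii)), so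
the three birational operations that [EtTh] §4–5 use (Mochizuki, *The étale theta function …*,
Publ. RIMS **45** (2009), §4 p. 312: "pre-steps of `C` map to isomorphisms in `C^birat` [cf. [FrdI],
Proposition 4.4, (iv)] … any base-equivalent pair of pre-steps `s', s'' : A → B` … determines … an
element '`s' · (s'')⁻¹`' `∈ O^×(A^birat)`"; Def. 4.1 (iii) "the natural action of `H_A`" on
`O^×(A^birat)`) are explicit, and this file records them for the merge adapter of the abc-iut cell
(unit W2-L2-05; consumers: abc-iut-L2-t3's `BiKummerSetting` fields `biratAut`, `restrictAlong`,
`fracOf`, abc-iut-L2-t4's `DivisorPrimeData.actGp`):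

* `baseAct F X : Aut X →* MulAut (F(Base X))` — the action of `Aut_C(X)` on the value at `Base X` of
  ANY monoid `F` on `D` through `Aut_C(X) → Aut_D(Base X)` and the functoriality of `F` (push-forward
  along `Base α`, i.e. pull-back along `Base α⁻¹`); instances: `F = B` (action on `O^×(X^birat)`),
  `F = Φ^gp` (action on divisors);
* `biratRestrict s h : B(Base X) ≃* B(Base Y)` for a base-isomorphism `s : X ⟶ Y` — "pre-steps map to
  isomorphisms in `C^birat`", `f ↦ f|_Y`;
* `frac s' s'' : B(Base X)` (for `B(Base X)` group-like) — the element "`s' · (s'')⁻¹`" of a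
  base-equivalent pair, `u_{s'} · u_{s''}⁻¹`, with `Div_B(s' · (s'')⁻¹) = Div(s') − Div(s'')`
  (`divB_frac`): its divisor of zeroes and poles.

Multiplicative notation (`Div(s') − Div(s'') ↦ of (div s') / of (div s'')`); composition
diagrammatic; `Aut X` multiplies by `α * β = β ≪≫ α`, `MulAut M` by `(e₁ * e₂) m = e₁ (e₂ m)`.  Not
here: the birationalization `C^birat` as a category ([FrdI] Prop. 4.4, seat abc-iut-L1-t3) — only its
shadow on the model data.
-/

noncomputable section

namespace Literature.AlgebraicGeometry.Frobenioids

namespace ModelFrobenioid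

open CategoryTheory Opposite

universe w v u

variable {D : Type u} [Category.{v} D] {Φ B : Dᵒᵖ ⥤ CommMonCat.{w}} {DivB : B ⟶ monoidGp Φ}

/-! ### The action of `Aut_C(X)` on `F(Base X)` for a monoid `F` on `D` -/

/-- For an automorphism `α` of `X`: `Base(α) ∘ Base(α⁻¹) = id`. [cite: MochizukiFrdI2008, Thm. 5.2(i) p.100] -/
theorem baseMap_hom_inv (X : ModelFrobenioid Φ B DivB) (α : Aut X) :
    baseMap α.hom ≫ baseMap α.inv = 𝟙 X.base := by
  rw [← baseMap_comp, α.hom_inv_id, baseMap_id]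

/-- For an automorphism `α` of `X`: `Base(α⁻¹) ∘ Base(α) = id`. [cite: MochizukiFrdI2008, Thm. 5.2(i) p.100] -/
theorem baseMap_inv_hom (X : ModelFrobenioid Φ B DivB) (α : Aut X) :
    baseMap α.inv ≫ baseMap α.hom = 𝟙 X.base := by
  rw [← baseMap_comp, α.inv_hom_id, baseMap_id]

/-- Transport along the two halves of `Base(α)` for a monoid `F` on `D` composes to the identity.
[cite: MochizukiFrdI2008, Thm. 5.2(i) p.100] -/
theorem map_baseMap_hom_inv_apply (F : Dᵒᵖ ⥤ CommMonCat.{w}) (X : ModelFrobenioid Φ B DivB) (α : Aut X)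
    (x : F.obj (op X.base)) : (F.map (baseMap α.hom).op).hom ((F.map (baseMap α.inv).op).hom x) = x := by
  rw [← CommMonCat.comp_apply, ← F.map_comp, ← op_comp, baseMap_hom_inv, op_id, F.map_id,
    CommMonCat.id_apply]

/-- Transport along the two halves of `Base(α)`, the other way round. [cite: MochizukiFrdI2008, Thm. 5.2(i) p.100] -/
theorem map_baseMap_inv_hom_apply (F : Dᵒᵖ ⥤ CommMonCat.{w}) (X : ModelFrobenioid Φ B DivB) (α : Aut X)
    (x : F.obj (op X.base)) : (F.map (baseMap α.inv).op).hom ((F.map (baseMap α.hom).op).hom x) = x := by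
  rw [← CommMonCat.comp_apply, ← F.map_comp, ← op_comp, baseMap_inv_hom, op_id, F.map_id,
    CommMonCat.id_apply]

/-- The automorphism of `F(Base X)` induced by `α ∈ Aut_C(X)`: push-forward along `Base(α)`, i.e.
`F(Base(α⁻¹))`, with inverse `F(Base(α))` (for a monoid `F` on `D`; used with `F = B`, `F = Φ^gp`).
[cite: MochizukiFrdI2008, Thm. 5.2(ii) p.101] -/
def baseActEquiv (F : Dᵒᵖ ⥤ CommMonCat.{w}) (X : ModelFrobenioid Φ B DivB) (α : Aut X) :
    F.obj (op X.base) ≃* F.obj (op X.base) where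
  toFun := (F.map (baseMap α.inv).op).hom
  invFun := (F.map (baseMap α.hom).op).hom
  left_inv x := map_baseMap_hom_inv_apply F X α x
  right_inv x := map_baseMap_inv_hom_apply F X α x
  map_mul' x y := map_mul _ x y

/-- `baseActEquiv` on elements. [cite: MochizukiFrdI2008, Thm. 5.2(ii) p.101] -/
@[simp] theorem baseActEquiv_apply (F : Dᵒᵖ ⥤ CommMonCat.{w}) (X : ModelFrobenioid Φ B DivB)
    (α : Aut X) (x : F.obj (op X.base)) : baseActEquiv F X α x = (F.map (baseMap α.inv).op).hom x := rfl

/-- **The natural action of `Aut_C(X)` on `F(Base X)`** through `Aut_C(X) → Aut_D(Base X)` and the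
functoriality of the monoid `F` on `D`, as a group homomorphism `Aut_C(X) → Aut(F(Base X))`
([EtTh] Def. 4.1 (iii): "the natural action of `H_A` [`⊆ Aut_C(A)/O^×(A)`]" on `O^×(A^birat) = B(A)`;
[EtTh] Prop. 5.3 (vi): "the `Aut_C(A_⊚)`-orbit" in `Φ(A_⊚)^gp`). [cite: MochizukiFrdI2008, Thm. 5.2(ii) p.101] -/
def baseAct (F : Dᵒᵖ ⥤ CommMonCat.{w}) (X : ModelFrobenioid Φ B DivB) : Aut X →* MulAut (F.obj (op X.base)) where
  toFun α := baseActEquiv F X α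
  map_one' := by
    apply MulEquiv.ext
    intro x
    change (F.map (baseMap (𝟙 X)).op).hom x = x
    rw [baseMap_id, op_id, F.map_id, CommMonCat.id_apply]
  map_mul' α β := by
    apply MulEquiv.ext
    intro x
    change (F.map (baseMap (α.inv ≫ β.inv)).op).hom x =
      (F.map (baseMap α.inv).op).hom ((F.map (baseMap β.inv).op).hom x)
    rw [baseMap_comp, op_comp, F.map_comp, CommMonCat.comp_apply]

/-- `baseAct` on elements: `α · x = F(Base(α⁻¹))(x)`. [cite: MochizukiFrdI2008, Thm. 5.2(ii) p.101] -/
@[simp] theorem baseAct_apply (F : Dᵒᵖ ⥤ CommMonCat.{w}) (X : ModelFrobenioid Φ B DivB) (α : Aut X)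
    (x : F.obj (op X.base)) : baseAct F X α x = (F.map (baseMap α.inv).op).hom x := rfl

/-- `O^×(X)` acts trivially: a base-identity automorphism induces the identity of `F(Base X)` (so the
action factors through `Aut_C(X)/O^×(X)`, as in [EtTh] Def. 4.1 (ii)–(iii)).
[cite: MochizukiFrdI2008, Thm. 5.2(ii) p.101] -/
theorem baseAct_eq_one_of_mem_units (F : Dᵒᵖ ⥤ CommMonCat.{w}) (X : ModelFrobenioid Φ B DivB)
    {α : Aut X} (hα : α ∈ units X) : baseAct F X α = 1 := by
  apply MulEquiv.ext
  intro x
  rw [baseAct_apply, (baseMap_inv_of_mem_units hα).1, op_id, F.map_id, CommMonCat.id_apply,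
    MulAut.one_apply]

/-- **The action of `Aut_C(X)` on `O^×(X^birat) = B(Base X)`** (`F = B`).
[cite: MochizukiFrdI2008, Thm. 5.2(ii) p.101] -/
abbrev biratAct (X : ModelFrobenioid Φ B DivB) : Aut X →* MulAut (B.obj (op X.base)) := baseAct B X

/-- **The action of `Aut_C(X)` on `Φ(Base X)^gp`** (`F = Φ^gp`). [cite: MochizukiFrdI2008, Thm. 5.2(ii) p.101] -/
abbrev divisorActGp (X : ModelFrobenioid Φ B DivB) :
    Aut X →* MulAut (Algebra.GrothendieckGroup (Φ.obj (op X.base))) := baseAct (monoidGp Φ) X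

/-- The two actions are compatible with `Div_B : B → Φ^gp` (naturality of `Div_B`).
[cite: MochizukiFrdI2008, Thm. 5.2(ii) p.101] -/
theorem divB_biratAct (X : ModelFrobenioid Φ B DivB) (α : Aut X) (u : B.obj (op X.base)) :
    divB Φ B DivB (op X.base) (biratAct X α u) = divisorActGp X α (divB Φ B DivB (op X.base) u) := by
  change divB Φ B DivB (op X.base) ((B.map (baseMap α.inv).op).hom u) =
    pullGp Φ (baseMap α.inv) (divB Φ B DivB (op X.base) u)
  exact (pullGp_divB (baseMap α.inv) u).symm

/-! ### Base-isomorphisms become isomorphisms birationally: `f ↦ f|_Y` -/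

/-- **"Pre-steps of `C` map to isomorphisms in `C^birat`"** ([FrdI] Prop. 4.4 (iv); [EtTh] §4 p.312,
Def. 4.1 (i) "`f|_B ∈ O^×(B^birat)` for the element determined by `(s', s'')`"): for a morphism
`s : X ⟶ Y` whose `Base(s)` is an isomorphism, `B(Base X) ⥲ B(Base Y)`, `f ↦ f|_Y := B(Base(s)⁻¹)(f)`,
with inverse the pull-back `B(Base s)`. [cite: MochizukiFrdI2008, Thm. 5.2(ii) p.101] -/
def biratRestrict {X Y : ModelFrobenioid Φ B DivB} (s : X ⟶ Y) [IsIso (baseMap s)] :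
    B.obj (op X.base) ≃* B.obj (op Y.base) where
  toFun := (B.map (inv (baseMap s)).op).hom
  invFun := (B.map (baseMap s).op).hom
  left_inv x := by
    rw [← CommMonCat.comp_apply, ← B.map_comp, ← op_comp, IsIso.hom_inv_id, op_id, B.map_id,
      CommMonCat.id_apply]
  right_inv x := by
    rw [← CommMonCat.comp_apply, ← B.map_comp, ← op_comp, IsIso.inv_hom_id, op_id, B.map_id,
      CommMonCat.id_apply]
  map_mul' x y := map_mul _ x y

/-- `biratRestrict` on elements. [cite: MochizukiFrdI2008, Thm. 5.2(ii) p.101] -/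
@[simp] theorem biratRestrict_apply {X Y : ModelFrobenioid Φ B DivB} (s : X ⟶ Y) [IsIso (baseMap s)]
    (x : B.obj (op X.base)) : biratRestrict s x = (B.map (inv (baseMap s)).op).hom x := rfl

/-- The pull-back `B(Base s)` undoes `biratRestrict s`. [cite: MochizukiFrdI2008, Thm. 5.2(ii) p.101] -/
@[simp] theorem biratRestrict_symm_apply {X Y : ModelFrobenioid Φ B DivB} (s : X ⟶ Y) [IsIso (baseMap s)]
    (y : B.obj (op Y.base)) : (biratRestrict s).symm y = (B.map (baseMap s).op).hom y := rfl

/-- `biratRestrict` depends only on `Base(s)`: base-equivalent base-isomorphisms restrict alike.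
[cite: MochizukiFrdI2008, Thm. 5.2(ii) p.101] -/
theorem biratRestrict_eq_of_baseMap_eq {X Y : ModelFrobenioid Φ B DivB} (s s' : X ⟶ Y) [IsIso (baseMap s)]
    [IsIso (baseMap s')] (h : baseMap s = baseMap s') : biratRestrict s = biratRestrict s' := by
  apply MulEquiv.ext
  intro x
  simp only [biratRestrict_apply, h]

/-! ### The fraction `s' · (s'')⁻¹` of a base-equivalent pair -/

/-- The rational function `u_φ ∈ B(Base X)` of a morphism as a unit, when `B(Base X)` is group-like
("`B` a group-like monoid on `D`", Thm. 5.2). [cite: MochizukiFrdI2008, Thm. 5.2 p.100] -/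
def unitU {X Y : ModelFrobenioid Φ B DivB} (hB : ∀ b : B.obj (op X.base), IsUnit b) (φ : X ⟶ Y) :
    (B.obj (op X.base))ˣ :=
  (hB (unit φ)).unit

/-- `unitU` is `u_φ`. [cite: MochizukiFrdI2008, Thm. 5.2 p.100] -/
@[simp] theorem coe_unitU {X Y : ModelFrobenioid Φ B DivB} (hB : ∀ b : B.obj (op X.base), IsUnit b)
    (φ : X ⟶ Y) : (unitU hB φ : B.obj (op X.base)) = unit φ := rfl

/-- **The fraction "`s' · (s'')⁻¹`"** `∈ O^×(X^birat) = B(Base X)` of a pair of morphisms `s', s'' : X ⟶ Y`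
([EtTh] §4 p.312: "any base-equivalent pair of pre-steps `s', s'' : A → B` in `C` determines, by
inverting the image of `s''` in `C^birat`, an element … `∈ O^×(A^birat)`"): in the model, `u_{s'} · u_{s''}⁻¹`
(`B(Base X)` group-like). [cite: MochizukiFrdI2008, Thm. 5.2(ii) p.101] -/
def frac {X Y : ModelFrobenioid Φ B DivB} (hB : ∀ b : B.obj (op X.base), IsUnit b) (s' s'' : X ⟶ Y) :
    (B.obj (op X.base))ˣ :=
  unitU hB s' / unitU hB s''

/-- **Divisor of zeroes and poles of the fraction**: for base-equivalent `s', s''` of the same Frobenius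
degree, `Div_B(s' · (s'')⁻¹) = Div(s') − Div(s'')` in `Φ(Base X)^gp` (subtract the relations (d) of
Thm. 5.2 (i) for `s'` and `s''`; [EtTh] Def. 4.1 (i): `Div(s')` the zero divisor, `Div(s'')` the divisor
of poles). [cite: MochizukiFrdI2008, Thm. 5.2(ii) p.101] -/
theorem divB_frac {X Y : ModelFrobenioid Φ B DivB} (hB : ∀ b : B.obj (op X.base), IsUnit b)
    (s' s'' : X ⟶ Y) (hb : baseMap s' = baseMap s'') (hd : degFr s' = degFr s'') :
    divB Φ B DivB (op X.base) (frac hB s' s'' : B.obj (op X.base)) =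
      Algebra.GrothendieckGroup.of (div s') / Algebra.GrothendieckGroup.of (div s'') := by
  have e' : divB Φ B DivB (op X.base) (unit s') = (pullGp Φ (baseMap s'') Y.cls)⁻¹ *
      (X.cls ^ (degFr s'' : ℕ) * Algebra.GrothendieckGroup.of (div s')) := by
    apply eq_inv_mul_of_mul_eq
    rw [← hb, ← hd]
    exact (rel s').symm
  have e'' : divB Φ B DivB (op X.base) (unit s'') = (pullGp Φ (baseMap s'') Y.cls)⁻¹ *
      (X.cls ^ (degFr s'' : ℕ) * Algebra.GrothendieckGroup.of (div s'')) := by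
    apply eq_inv_mul_of_mul_eq
    exact (rel s'').symm
  rw [frac, div_eq_mul_inv, Units.val_mul, map_mul, map_units_inv, coe_unitU, coe_unitU, e', e'',
    ← div_eq_mul_inv, mul_div_mul_left_eq_div, mul_div_mul_left_eq_div]

/-- The fraction of a pair with itself is trivial. [cite: MochizukiFrdI2008, Thm. 5.2(ii) p.101] -/
@[simp] theorem frac_self {X Y : ModelFrobenioid Φ B DivB} (hB : ∀ b : B.obj (op X.base), IsUnit b)
    (s : X ⟶ Y) : frac hB s s = 1 := div_self' _

/-- Swapping the pair inverts the fraction. [cite: MochizukiFrdI2008, Thm. 5.2(ii) p.101] -/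
theorem frac_swap {X Y : ModelFrobenioid Φ B DivB} (hB : ∀ b : B.obj (op X.base), IsUnit b)
    (s' s'' : X ⟶ Y) : frac hB s'' s' = (frac hB s' s'')⁻¹ := by
  rw [frac, frac, inv_div]

end ModelFrobenioid

end Literature.AlgebraicGeometry.Frobenioids
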